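import Summits.CriticalPhenomena.Ising3DConformalLimit.Theses.ArmHyperscaling
import Literature.Probability.LatticeModels.IsingMonotonicity
import HarnessLib

/-!
# Sketch — crux-ideate stmt-CriticalPhenomena-15591 (OneArmHyperscaling), ideator k = 2, round 1

First lemmas of the two idea cards, stated over existing declarations (they need not be proved
here; they must elaborate).  The vocabulary `evalSite … plusBoxMag` is copied verbatim from the
registered line `Cruxes/OneArmHyperscaling/Lines/mirror_face_saturation.lean` (that module is not
built on the farm, so it cannot be imported).

* Card `forced-intersection`: `GKSSaturation`, `PlusForgettingHyp`, `gksSaturation_gives_forgetting`,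
  `forgetting_and_saturation_give_crux`.
* Card `lee-yang-foster-response`: `plateSum`, `lyGap`, `FaceSaturationLY` (Z1), `PlateLYPinching` (Z2),
  `faceMag_ge_lyGap_mul_faceResponse` (provable-now support, "Tasaki for faces"),
  `faceSaturation_of_Z1_Z2` (sorry-free glue into the registered open stub `FaceSaturation`).
-/

noncomputable section

namespace Summit.CriticalPhenomena.Ising3DConformalLimit.Cruxes.OneArmHyperscaling.IdeasK2

open Literature.Probability.LatticeModels Finset
open Summit.CriticalPhenomena.Ising3DConformalLimit.Theses.ArmHyperscaling

/-! ### Vocabulary copied from the registered line `mirror_face_saturation` -/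

def evalSite (n : ℕ) : Site 3 := Pi.single 0 (n : ℤ)

def facePatch (K n : ℕ) : Finset (Site 3) :=
  Fintype.piFinset fun i : Fin 3 =>
    if i = 0 then ({(n : ℤ) - ((K * n : ℕ) : ℤ) - 1} : Finset ℤ)
    else Finset.Icc (-((K * n : ℕ) : ℤ)) ((K * n : ℕ) : ℤ)

def mirrorPatch (K n : ℕ) : Finset (Site 3) :=
  Fintype.piFinset fun i : Fin 3 =>
    if i = 0 then ({((K * n : ℕ) : ℤ) + 1 - (n : ℤ)} : Finset ℤ)
    else Finset.Icc (-((K * n : ℕ) : ℤ)) ((K * n : ℕ) : ℤ)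

def critExpect (F : SpinConfig (Site 3) → ℝ) : ℝ :=
  plusExpect 3 (criticalBeta 3) 0 F

def faceMag (K n : ℕ) : ℝ :=
  critExpect (fun σ => spinAt (evalSite n) σ * plusIndicator (facePatch K n) σ) /
    critExpect (plusIndicator (facePatch K n))

def faceResponse (K n : ℕ) : ℝ :=
  ∑ y ∈ facePatch K n, criticalCorr 3 2 ![evalSite n, y]

def mirrorGram (K n : ℕ) : ℝ :=
  ∑ y ∈ mirrorPatch K n, ∑ y' ∈ facePatch K n, criticalCorr 3 2 ![y, y']

def plusBoxMag (K n : ℕ) : ℝ :=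
  isingCorr (zdGraph 3) (box 3 (K * n)) (criticalBeta 3) 0 BoundaryCondition.plus ({0} : Finset (Site 3))

/-- The registered open core of the line `mirror-face-saturation` (verbatim). -/
def FaceSaturation : Prop :=
  ∃ K : ℕ, 2 ≤ K ∧ ∃ C : ℝ, ∀ n : ℕ, 1 ≤ n →
    faceMag K n ≤ C * faceResponse K n / Real.sqrt (mirrorGram K n)

/-! ## Card 1 · `forced-intersection` -/

/-- The source spin `x_n = 2n e₀` of the crux. -/
def src (n : ℕ) : Site 3 := Pi.single 0 (2 * (n : ℤ))

/-- The inner boundary layer of the box `Λ_{Kn}` (sites of the box with a neighbour outside):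
the support of the boundary source sets `A` produced by expanding the `+` boundary condition
into currents on the boundary edges. -/
def innerLayer (K n : ℕ) : Finset (Site 3) :=
  (box 3 (K * n)).filter fun a => ∃ i : Fin 3, |a i| = ((K * n : ℕ) : ℤ)

/-- **(SAT_K,C) uniform GKS-II saturation against boundary insertions.**  In the FREE box
`Λ_{Kn}` at `β_c(3)`, for every even set `A` of inner-boundary sites,
`⟨σ₀ σ_x σ_A⟩^∅ ≤ C ⟨σ₀σ_x⟩^∅ ⟨σ_A⟩^∅`, `x = 2n e₀`.  By the switching lemma
(`isingCorr_mul_eq_doubleCurrent_subcurrent_holds`) the ratio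
`⟨σ₀σ_x⟩⟨σ_A⟩/⟨σ₀σ_xσ_A⟩` is the probability, under the double current with sources
`{0,x} ∪ A` and `∅`, that `n₁ + n₂` contains a sub-current with sources `{0,x}` — in particular
that `0 ↔ x`: SAT is a CONNECTION FLOOR for two boundary-anchored arms. -/
def GKSSaturation (K : ℕ) (C : ℝ) : Prop :=
  ∀ n : ℕ, 1 ≤ n → ∀ A : Finset (Site 3), A ⊆ innerLayer K n → Even A.card →
    Disjoint A ({0, src n} : Finset (Site 3)) →
      isingCorr (zdGraph 3) (box 3 (K * n)) (criticalBeta 3) 0 BoundaryCondition.free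
          (({0, src n} : Finset (Site 3)) ∪ A)
        ≤ C * isingCorr (zdGraph 3) (box 3 (K * n)) (criticalBeta 3) 0 BoundaryCondition.free
              ({0, src n} : Finset (Site 3))
            * isingCorr (zdGraph 3) (box 3 (K * n)) (criticalBeta 3) 0 BoundaryCondition.free A

/-- The hypothesis of the route's support item `ForgettingGivesOneArm` (verbatim):
two-point `+`-boundary forgetting at one macroscopic ratio. -/
def PlusForgettingHyp : Prop :=
  ∃ K : ℕ, 3 ≤ K ∧ ∃ C : ℝ, ∀ n : ℕ, 1 ≤ n →
    isingCorr (zdGraph 3) (box 3 (K * n)) (criticalBeta 3) 0 BoundaryCondition.plus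
        ({0, Pi.single 0 (2 * (n : ℤ))} : Finset (Site 3))
      ≤ C * criticalTwoPoint 3 (Pi.single 0 (2 * (n : ℤ)))

/-- **First lemma of card 1 (provable now, M-sized).**  Expanding the `+` boundary condition of
`Λ_{Kn}` into currents on the boundary edges writes `⟨σ₀σ_x⟩⁺_Λ / ⟨σ₀σ_x⟩^∅_Λ` as an average, over
the induced law of the odd-flux set `A ⊆ innerLayer`, of `⟨σ₀σ_xσ_A⟩^∅/(⟨σ₀σ_x⟩^∅⟨σ_A⟩^∅)`
(`plusCurrentSum` bookkeeping, `PlusCurrents.lean`); SAT bounds every term by `C`, and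
`⟨σ₀σ_x⟩^∅_Λ ≤ ⟨σ₀σ_x⟩_{β_c}` (GKS II in the volume, `hasBoxLimit_isingCorr_free`). -/
theorem gksSaturation_gives_forgetting :
    (∃ K : ℕ, 3 ≤ K ∧ ∃ C : ℝ, GKSSaturation K C) → PlusForgettingHyp := by
  sorry

/-- Composition with the route's own support item: SAT ∧ ForgettingGivesOneArm ⟹ the crux BY NAME. -/
theorem forgetting_and_saturation_give_crux
    (hFG : ForgettingGivesOneArm) (hSAT : ∃ K : ℕ, 3 ≤ K ∧ ∃ C : ℝ, GKSSaturation K C) :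
    OneArmHyperscaling :=
  hFG (gksSaturation_gives_forgetting hSAT)

/-! ## Card 2 · `lee-yang-foster-response` -/

/-- The plate magnetisation `M_{θA} = Σ_{y ∈ facePatch K n} σ_y`. -/
def plateSum (K n : ℕ) (σ : SpinConfig (Site 3)) : ℝ :=
  ∑ y ∈ facePatch K n, spinAt y σ

/-- **The Lee–Yang gap of the face**: the first positive real zero `y₁(K,n)` of
`θ ↦ ⟨cos(θ M_{θA})⟩_{β_c}` — by the Lee–Yang theorem the zeros of the face-field partition
function `h ↦ ⟨e^{h M_{θA}}⟩_{β_c}` are exactly `± i y_j (mod iπ)`, `0 < y₁ ≤ y₂ ≤ … ≤ π/2`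
(written like item `NearCriticalLeeYangGap` of route `LeeYangGap`). -/
def lyGap (K n : ℕ) : ℝ :=
  sInf {θ : ℝ | 0 < θ ∧ critExpect (fun σ => Real.cos (θ * plateSum K n σ)) = 0}

/-- **(Z1) saturation by the Lee–Yang scale — OPEN CORE of card 2.**  The far-spin response to the
face field saturates no later than the face's Lee–Yang gap predicts: `F ≤ C · y₁ · T`.  In the
Foster form `f(h) = Σ_j ρ_j · 2 sinh 2h/(cosh 2h − cos 2y_j)` (ρ_j ≥ 0) of the response this is
the FAIR-SHARE statement `Σ_{y_j ≤ Λ y₁} ρ_j ≥ c · y₁ · Σ_j ρ_j`. -/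
def FaceSaturationLY : Prop :=
  ∃ K : ℕ, 2 ≤ K ∧ ∃ C : ℝ, ∀ n : ℕ, 1 ≤ n → faceMag K n ≤ C * lyGap K n * faceResponse K n

/-- **(Z2) Lee–Yang pinching of the face at the mirror-Gram scale — the non-Gaussian input.**
`y₁(K,n)² · S_{K,n} ≤ C`: the Yang–Lee gap of a critical plate closes at the rate of its inverse
fluctuation (Newman: `12/s₁⁴ − 4σ² ≤ −κ₄(M) ≤ 6σ²/s₁²`, so this is a Binder-coupling floor for
the plate magnetisation; the plate analogue of `LeeYangGap.NearCriticalLeeYangGap`). -/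
def PlateLYPinching : Prop :=
  ∃ K : ℕ, 2 ≤ K ∧ ∃ C : ℝ, ∀ n : ℕ, 1 ≤ n → lyGap K n ^ 2 * mirrorGram K n ≤ C

/-- **Support (provable now, "Tasaki for faces"):** `F ≥ c · y₁ · T` with an absolute `c > 0`.
Multivariate Lee–Yang makes `f(h) = ⟨σ_x e^{hM}⟩/⟨e^{hM}⟩` positive-real on `Re h > 0`, hence a
Foster sum over its Lee–Yang poles with residues `ρ_j ≥ 0`, `F = 2Σρ_j`, `T = 2Σρ_j/sin²y_j`; GKS
monotonicity of `f` on `[0,∞)` gives `Σ_{y_j ≤ h} ρ_j ≤ C h F`, and summation by parts `T ≤ C'F/y₁`. -/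
theorem faceMag_ge_lyGap_mul_faceResponse :
    ∃ c : ℝ, 0 < c ∧ ∀ K n : ℕ, 2 ≤ K → 1 ≤ n → c * lyGap K n * faceResponse K n ≤ faceMag K n := by
  sorry

/-- **Glue (sorry-free): (Z1) ∧ (Z2) ⟹ the registered open stub `FaceSaturation`**, provided the
two witnesses use the same ratio `K` (stated with a common `K` to keep the glue one line of real
arithmetic; `F ≤ C₁ y₁ T` and `y₁ ≤ √(C₂/S)` give `F ≤ C₁√C₂ · T/√S`). -/
theorem faceSaturation_of_Z1_Z2
    (h : ∃ K : ℕ, 2 ≤ K ∧ ∃ C₁ C₂ : ℝ, ∀ n : ℕ, 1 ≤ n →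
      faceMag K n ≤ C₁ * lyGap K n * faceResponse K n ∧ lyGap K n ^ 2 * mirrorGram K n ≤ C₂ ∧
      0 ≤ lyGap K n ∧ 0 ≤ faceResponse K n ∧ 0 < mirrorGram K n ∧ 0 ≤ C₁) :
    FaceSaturation := by
  obtain ⟨K, hK, C₁, C₂, hn⟩ := h
  refine ⟨K, hK, C₁ * Real.sqrt C₂, fun n hn1 => ?_⟩
  obtain ⟨h1, h2, hy, hT, hS, hC₁⟩ := hn n hn1
  have hSsqrt : 0 < Real.sqrt (mirrorGram K n) := Real.sqrt_pos.mpr hS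
  -- y₁ ≤ √C₂ / √S
  have hy' : lyGap K n ≤ Real.sqrt C₂ / Real.sqrt (mirrorGram K n) := by
    rw [le_div_iff₀ hSsqrt]
    have : lyGap K n * Real.sqrt (mirrorGram K n) = Real.sqrt (lyGap K n ^ 2 * mirrorGram K n) := by
      rw [Real.sqrt_mul (sq_nonneg _), Real.sqrt_sq hy]
    rw [this]
    exact Real.sqrt_le_sqrt h2
  calc faceMag K n ≤ C₁ * lyGap K n * faceResponse K n := h1
    _ ≤ C₁ * (Real.sqrt C₂ / Real.sqrt (mirrorGram K n)) * faceResponse K n := by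
        gcongr
    _ = C₁ * Real.sqrt C₂ * faceResponse K n / Real.sqrt (mirrorGram K n) := by ring

end Summit.CriticalPhenomena.Ising3DConformalLimit.Cruxes.OneArmHyperscaling.IdeasK2

end
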